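import Mathlib
import HarnessLib
import Summits.HubbardSuperconductivity.HubbardSuperconductivity.Theorems.KLProgrammeKLRegimeEngineV8DefsU12bG
import Summits.HubbardSuperconductivity.HubbardSuperconductivity.Theorems.KLProgrammeKLRegimeEngineV8DefsG13
import Summits.HubbardSuperconductivity.HubbardSuperconductivity.Theorems.KLProgrammeKLRegimeEngineV8DefsG14
import Summits.HubbardSuperconductivity.HubbardSuperconductivity.Theorems.KLProgrammeKLRegimeEngineScaleZeroV17FRaiseGeo
import Summits.HubbardSuperconductivity.HubbardSuperconductivity.Theorems.KLProgrammeKLRegimeEngineTwoLegStepV17F2ZeroCloserRaise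
import Summits.HubbardSuperconductivity.HubbardSuperconductivity.Theorems.KLProgrammeKLRegimeEngineV8IsoMomentRow
import Summits.HubbardSuperconductivity.HubbardSuperconductivity.Theorems.KLProgrammeKLRegimeEngineScaleZeroLevelZeroFrame
import Summits.HubbardSuperconductivity.HubbardSuperconductivity.Theorems.KLProgrammeKLRegimeEngineKernelNormsWt4
import Summits.HubbardSuperconductivity.HubbardSuperconductivity.Theorems.KLProgrammeKLRegimeEngineV8DefsQ9c
import Summits.HubbardSuperconductivity.HubbardSuperconductivity.Theorems.KLProgrammeKLRegimeEngineV8DefsG11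
import Summits.HubbardSuperconductivity.HubbardSuperconductivity.Theorems.KLProgrammeKLRegimeSplitFlowPieceOscDefs
import Summits.HubbardSuperconductivity.HubbardSuperconductivity.Theorems.KLProgrammeKLRegimeTwoLegReadOscConsts

/-!
# K3 ENGINE (stmt-HubbardSuperconductivity-20437 `KLRegimeEngineV17F2`): the (a)/(M) CLOSERS and the (b) CLOSER-MODULO-PRODUCERS AT A GEOMETRY SLOT `G` — registrant PRESTAGE
# for the post-FREEZE G-token motion «AMENDMENT 24 — (c)-OUT» (plan g23 (R237)/(R243): `klEngGeo11 ↦ klEngGeo13`; candidate successor `klEngGeo14`, AMENDMENT 24+25 (R257));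
# cell gate-hubbard-kl, seat gate-hubbard-kl-p1b g16 (20437 v2 registrant lineage)

WHY.  The landed v2 stub credits (a)/(M) (`…EngineV17F2StubsScaleZero`, p662520, namespace `…EngineV8.FreezeV2`) and the (b) closer-modulo-producers
(`…EngineStepNormsV17F2OfProducers`, p662084) are keyed at the FROZEN G token `klEngGeo11` and the frozen doors `klEngC₃7 / klEngU₀12 / klZt…`.  Under a G-token motion of the
image (AMENDMENT 24, V-all: every `klEngGeo11` site ↦ the successor token `G'`, doors ↦ the registrant's G-generic `klEngC₃7G G' / klEngU₀12G G' / klZtG G' …` of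
`…GridLiteralsPkgG / …DefsU12bG / …TowerCoreDefsCG`; all seven rows move) the same three closers are needed AT `G'`.  This file states them ONCE, G-generic, and
instantiates the two scale-0 stubs at both candidate successors so that the post-registration stub-credit files are these texts verbatim:
* §1 **`stub_engine_scale0_G`** — stub (a)'s text at `(G, klEngQ9c P R, klEngC₃7G G, klEngU₀12G G, klEngL₄)` for ANY `G` with `initDevBar G = initDevBar klEngGeo8`,
  `klEngGeo8.cE4 ≤ G.cE4`, `klEngGeo8.CF ≤ G.CF` (= `stub_engine_scale0_geo_of_klEng8` ∘ the G-generic chain heads `klEngC₃7G_le_klEngC₃6` / `klEngU₀12G_le_klEngU₀10`);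
  **`stub_twoLeg_scale0_G`** — stub (M)'s text at `G` for ANY `G` with `klC4aJetC2 ≤ G.S` (= `stub_twoLeg_scale0_raise_G` ∘ the same heads);
* §2 **`stub_engine_step_norms_of_producers_G`** — stub (b)'s text at `G` (history/`EngineFirstMoments` at `G`, grid atom at `klZtG/klZs1G/klZs2G G`) from the three producers'
  ∃-statements AT `G` (E1's capped core `TowerCoreStepV2 G P R (klEngQ8 P R) …`, W3's G-free iso-moment witness, the grid producer `TwoLegGridMomentsStepCT P R (klEngQ7 P R) G …`),
  by rows only (`towerCoreC9G_at_klEngQ9c`, `twoLegGridFlowMomentsAtC_klZG_of_exists`, `isoFirstMomentsAt_flow_klIsoMomPack … G hG …`, the `klEngC₃7G_/klEngU₀12G_` rows) —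
  p662084's proof verbatim, re-keyed; `G.WF` is the only extra binder;
* §3 the instances: `initDevBar_klEngGeo13/14` (`rfl`: `scaleGains/addShellLogPP/addShellLog/raiseCF` are `atop/abot`-idle), `klEngGeo8_CF_le_klEngGeo13/14_CF`, and in the
  sub-namespaces **`…EngineV8.A24G13` / `…EngineV8.A24G14`** the theorems **`stub_engine_scale0`** / **`stub_twoLeg_scale0`** whose statements are the rev 15-A24 CANDIDATE rows
  (a) b6bd3a9d49a4 / (M) 44a79e0badf0 (G13 image 756ee7cf6e79b7c8) and (a) 120428addd1d / (M) eef18bb42ce4 (G14 image c83a8f7d69f2f229) VERBATIM.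
NOT A MOTION and NOT a stub credit: nothing here is registered; no token of record moves; the producer statements of §2 are HYPOTHESES.  Bookkeeping compositions of landed
theorems; nothing about the model is asserted; nothing asserts (b), any open stub of 20437, K3 or superconductivity.
-/

noncomputable section

namespace Summit.HubbardSuperconductivity.HubbardSuperconductivity.Theorems.EngineV8

set_option linter.dupNamespace false -- summit = problem name (single-conjunct summit), D-0017

open Real Finset Literature.MathematicalPhysics.QuantumLattice Literature.Probability.LatticeModels
open Summit.HubbardSuperconductivity.HubbardSuperconductivity.Theorems.KLRegimeSplit
open Summit.HubbardSuperconductivity.HubbardSuperconductivity.Theorems.KLProgrammeLegKernels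
open Summit.HubbardSuperconductivity.HubbardSuperconductivity.Theorems.DispersionFlow

/-! ## §1 Stubs (a)/(M) at a geometry slot `G`, frozen doors re-keyed at `G` -/

/-- **STUB (a) AT A GEOMETRY SLOT**: for any `G` with `initDevBar G U = initDevBar klEngGeo8 U`, `klEngGeo8.cE4 ≤ G.cE4`, `klEngGeo8.CF ≤ G.CF`, the (a) text of a G-keyed
image (doors `klEngC₃7G G P R`, `klEngU₀12G G P R c`). -/
theorem stub_engine_scale0_G (G : GeoConsts) (hID : ∀ U : ℝ, initDevBar G U = initDevBar klEngGeo8 U) (hE4 : klEngGeo8.cE4 ≤ G.cE4)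
    (hCF : klEngGeo8.CF ≤ G.CF) :
    ∀ (P : SplitConsts) (R : RenConsts) (c : ℝ), P.WF → R.WF2 → 0 < c → c ≤ klEngC₃7G G P R →
      ∀ μ ∈ klWindowC, ∀ U : ℝ, 0 < U → U ≤ klEngU₀12G G P R c → ∀ β : ℝ, klBetaMin ≤ β → β ≤ Real.exp (c / U ^ 2) →
        ∀ (L M : ℕ) [NeZero L] [NeZero M], klEngL₄ P R β U ≤ L → klEngM₃ β U L ≤ M →
          FrameOK R U (nScales β) μ (klFlowFrameU L M β U μ 0) →
            KernelNormsV4 L M P (klEngQ9c P R) β U μ (klFlowFrameU L M β U μ 0) 0 ∧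
              PairLadderStepAtV17F2 L M G P (klEngQ9c P R) β U μ 0 ∧
                QuarticValueUVAtV17F L M G P (klEngQ9c P R) β U μ 0 ∧
                  EngineFirstMoments L M G P (klEngQ9c P R) β U μ (klFlowFrameU L M β U μ 0) 0 ∧
                    IsoTupleL1AtV17F L M G P β U μ 0 :=
  fun P R c hP hR hc hc3 μ hμ U hU hUle β hβ hβc L M _ _ hL hM hfr =>
    stub_engine_scale0_geo_of_klEng8 G hID hE4 hCF (fun P R => klEngQ9c P R) isRaiseOf_klEngQ9c_family P R c hP hR hc
      (hc3.trans (klEngC₃7G_le_klEngC₃6 G P R)) μ hμ U hU (hUle.trans (klEngU₀12G_le_klEngU₀10 G P R c)) β hβ hβc L M hL hM hfr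

/-- **STUB (M) AT A GEOMETRY SLOT**: for any `G` whose jet table dominates `klC4aJetC2`, the (M) text of a G-keyed image (doors `klEngC₃7G G`, `klEngU₀12G G`). -/
theorem stub_twoLeg_scale0_G (G : GeoConsts) (hS : ∀ k, klC4aJetC2 k ≤ G.S k) :
    ∀ (P : SplitConsts) (R : RenConsts) (c : ℝ), P.WF → R.WF2 → 0 < c → c ≤ klEngC₃7G G P R →
      ∀ μ ∈ klWindowC, ∀ U : ℝ, 0 < U → U ≤ klEngU₀12G G P R c → ∀ β : ℝ, klBetaMin ≤ β → β ≤ Real.exp (c / U ^ 2) →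
        ∀ (L M : ℕ) [NeZero L] [NeZero M], klEngL₄ P R β U ≤ L → klEngM₃ β U L ≤ M →
          FrameOK R U (nScales β) μ (klFlowFrameU L M β U μ 0) →
            EngineBoundsAtV17F2 L M G P (klEngQ9c P R) β U μ 0 →
              TwoLegReadJetBound L M klC4aJetC2 (klC4aJetC' P R) β U μ (klFlowFrameU L M β U μ 0) 0 →
                TwoLegStepV17F2 L M G P (klEngQ9c P R) R β U μ 0 :=
  fun P R c hP hR hc hc3 μ hμ U hU hUle β hβ hβc L M _ _ hL hM hfr hE hJ =>
    stub_twoLeg_scale0_raise_G G P R (klEngQ9c P R) (isRaiseOf_klEngQ9c P R) klC4aJetC2 hS c hP hR hc (hc3.trans (klEngC₃7G_le_klEngC₃6 G P R)) μ hμ U hU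
      (hUle.trans (klEngU₀12G_le_klEngU₀10 G P R c)) β hβ hβc L M hL hM hfr hE hJ

/-! ## §2 Stub (b) at a geometry slot `G` from its three producers' ∃-statements AT `G` -/

/-- **STUB (b) AT A GEOMETRY SLOT FROM ITS THREE PRODUCERS' ∃-STATEMENTS** (p662084's composition re-keyed at `G`; `G.WF` the only extra binder). -/
theorem stub_engine_step_norms_of_producers_G (G : GeoConsts) (hG : G.WF)
    (hexT : ∀ (P : SplitConsts) (R : RenConsts), P.WF → R.WF2 →
      ∃ e : ℝ × (EngConsts → ℝ → ℝ) × ℝ, IsTowerPkgC e ∧ e.1 ≤ klEngQ9cCE P R ∧ TowerCoreStepV2 G P R (klEngQ8 P R) e.1 e.2.1 e.2.2)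
    (hexI : ∃ Edu : ℝ × (SplitConsts → RenConsts → ℝ) × (GeoConsts → SplitConsts → RenConsts → EngConsts → ℝ → ℝ),
      0 ≤ Edu.1 ∧ (∀ P R, 0 ≤ Edu.2.1 P R) ∧ (∀ G P R Q cc, 0 < Edu.2.2 G P R Q cc) ∧ IsoMomFlowAt Edu.1 Edu.2.1 Edu.2.2)
    (hexG : ∀ (P : SplitConsts) (R : RenConsts), P.WF → R.WF2 →
      ∃ e : (ℝ × ℝ × ℝ) × (EngConsts → ℝ → ℝ) × ℝ, IsGridLitPkg R e ∧ TwoLegGridMomentsStepCT P R (klEngQ7 P R) G e.1 e.2.1 e.2.2) :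
    ∀ (P : SplitConsts) (R : RenConsts) (c : ℝ), P.WF → R.WF2 → 0 < c → c ≤ klEngC₃7G G P R →
      ∀ μ ∈ klWindowC, ∀ U : ℝ, 0 < U → U ≤ klEngU₀12G G P R c → ∀ β : ℝ, klBetaMin ≤ β → β ≤ Real.exp (c / U ^ 2) →
        ∀ (L M : ℕ) [NeZero L] [NeZero M], klEngL₄ P R β U ≤ L → klEngM₃ β U L ≤ M →
          ∀ n : ℕ, 1 ≤ n → n ≤ nScales β + 1 → IsKLRegime U c (-(n : ℤ)) →
            HistP klPredsV17F2 L M G P (klEngQ9c P R) R β U μ 0 n →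
              (∀ m, 1 ≤ m → m < n → FlowPieceOscAt L M (klReadOscC P R) β U μ m) →
              FrameOK R U (nScales β) μ (klFlowFrameU L M β U μ n) →
                (∀ j ≤ n, LevelsUExportMixedAt L M (klCU2 P R (klEngQ7 P R)) P β U μ j) →
                  KernelNormsV4 L M P (klEngQ9c P R) β U μ (klFlowFrameU L M β U μ n) n ∧
                    (∀ j ≤ n, (KernelNormsLevels L M P (klEngQ9c P R) β U μ (klFlowFrameU L M β U μ n) j ∧
                      KernelNormsWt4 L M (klWtBudget P (klEngQ9c P R) U j) β U μ (klFlowFrameU L M β U μ n) j)) ∧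
                    EngineFirstMoments L M G P (klEngQ9c P R) β U μ (klFlowFrameU L M β U μ n) n ∧
                    IsoFirstMomentsAt L M klIsoMomC (klIsoMomD P R) P β U μ n ∧
                    TwoLegGridFlowMomentsAtC L M (klZtG G P R) (klZs1G G P R) (klZs2G G P R) c β U μ n := by
  intro P R c hP hR hc hc3 μ hμ U hU hUle β hβ hβc L M _ _ hL hM n hn1 hn hreg hhist hosc hfr hlevU
  have hc36 : c ≤ klEngC₃6 P R := hc3.trans (klEngC₃7G_le_klEngC₃6 G P R)
  have hU10 : U ≤ klEngU₀10 P R c := hUle.trans (klEngU₀12G_le_klEngU₀10 G P R c)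
  have hβ0 : 0 ≤ β := le_trans (by norm_num [klBetaMin]) hβ
  -- tower core at (G, klEngQ9c): levels `1 ≤ j ≤ n` and first moments (…TowerCoreDefsCG §2)
  obtain ⟨hlev1, hE4⟩ := towerCoreC9G_at_klEngQ9c (hexT P R hP hR) hc hc36 (hc3.trans (klEngC₃7G_le_klTowerCoreCC9G G P R)) hμ hU hU10
    (hUle.trans (klEngU₀12G_le_klTowerCoreUC9G G P R c)) hβ hβc hL hM hn1 hn hreg hhist hosc hfr hlevU
  -- level `j = 0` at `K_n` from the scale-0 rung (G-free), conjunct 1 from the weighted bundle at `j = n`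
  have h0 := levelZero_norms_frame_of_isRaiseOf_U10L4 P R (klEngQ9c P R) (isRaiseOf_klEngQ9c P R) c hP hR hc hc36 μ hμ U hU hU10 β hβ hβc
    (klFlowFrameU L M β U μ n) hfr L M hL hM
  have hlev : ∀ j ≤ n, KernelNormsLevels L M P (klEngQ9c P R) β U μ (klFlowFrameU L M β U μ n) j ∧
      KernelNormsWt4 L M (klWtBudget P (klEngQ9c P R) U j) β U μ (klFlowFrameU L M β U μ n) j := by
    intro j hj
    rcases Nat.eq_zero_or_pos j with rfl | hj1
    · exact ⟨h0.2.1, h0.2.2⟩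
    · exact hlev1 j hj1 hj
  have hV4 : KernelNormsV4 L M P (klEngQ9c P R) β U μ (klFlowFrameU L M β U μ n) n :=
    kernelNormsV4_of_kernelNormsWt4_klWtBudget hβ0 (hlev n le_rfl).2
  -- conjunct 4: the iso-moment row from W3's witness through the deferred package, at G
  obtain ⟨⟨E, d, u⟩, hE0, hd, hu, hE⟩ := hexI
  have hiso := isoFirstMomentsAt_flow_klIsoMomPack hE0 hd hu hE G hG P R (klEngQ9c P R) c hP hR (klEngQ9c_wf P R) hc hc36 μ hμ
    U hU (hUle.trans (klEngU₀12G_le_klIsoMomU G P R c)) β hβ hβc L M hL hM n hn1 hn hreg hhist hfr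
  -- conjunct 5: the grid C-atom from the deferred grid-literal producer at G
  have hgrid := twoLegGridFlowMomentsAtC_klZG_of_exists (hexG P R hP hR) (isRaiseOf_klEngQ9c P R) hc hc36 (hc3.trans (klEngC₃7G_le_klGridLitCAtG G P R)) hμ
    hU hU10 (hUle.trans (klEngU₀12G_le_klGridLitUAtG G P R c)) hβ hβc hL hM hn1 hn hhist hfr hV4 hlev hlevU
  exact ⟨hV4, hlev, hE4, hiso, hgrid⟩

/-! ## §3 The instances at the two candidate successor tokens -/

/-- `initDevBar klEngGeo13 U = initDevBar klEngGeo8 U` (`scaleGains`/`addShellLogPP` are `atop/abot`-idle; definitional). -/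
theorem initDevBar_klEngGeo13 (U : ℝ) : initDevBar klEngGeo13 U = initDevBar klEngGeo8 U := rfl

/-- `initDevBar klEngGeo14 U = initDevBar klEngGeo8 U` (definitional). -/
theorem initDevBar_klEngGeo14 (U : ℝ) : initDevBar klEngGeo14 U = initDevBar klEngGeo8 U := rfl

/-- `klEngGeo8.CF ≤ klEngGeo13.CF`. -/
theorem klEngGeo8_CF_le_klEngGeo13_CF : klEngGeo8.CF ≤ klEngGeo13.CF := klEngGeo8_CF_le_klEngGeo11_CF.trans klEngGeo11_CF_le_klEngGeo13_CF

/-- `klEngGeo8.CF ≤ klEngGeo14.CF`. -/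
theorem klEngGeo8_CF_le_klEngGeo14_CF : klEngGeo8.CF ≤ klEngGeo14.CF := klEngGeo8_CF_le_klEngGeo13_CF.trans klEngGeo13_CF_le_klEngGeo14_CF

/-- `klEngGeo8.cE4 ≤ klEngGeo13.cE4` (equality, definitional). -/
theorem klEngGeo8_cE4_le_klEngGeo13_cE4 : klEngGeo8.cE4 ≤ klEngGeo13.cE4 := le_of_eq rfl

/-- `klEngGeo8.cE4 ≤ klEngGeo14.cE4` (equality, definitional). -/
theorem klEngGeo8_cE4_le_klEngGeo14_cE4 : klEngGeo8.cE4 ≤ klEngGeo14.cE4 := le_of_eq rfl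

/-- `klC4aJetC2 k ≤ klEngGeo13.S k` (`klEngGeo13.S = klEngGeo8.S`, definitional). -/
theorem klC4aJetC2_le_klEngGeo13_S (k : ℕ) : klC4aJetC2 k ≤ klEngGeo13.S k := klC4aJetC2_le_klEngGeo8_S k

/-- `klC4aJetC2 k ≤ klEngGeo14.S k` (definitional through `klEngGeo8.S`). -/
theorem klC4aJetC2_le_klEngGeo14_S (k : ℕ) : klC4aJetC2 k ≤ klEngGeo14.S k := klC4aJetC2_le_klEngGeo8_S k

end Summit.HubbardSuperconductivity.HubbardSuperconductivity.Theorems.EngineV8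

/-! ### rev 15-A24 CANDIDATE «klEngGeo13» (image 756ee7cf6e79b7c8): rows (a) b6bd3a9d49a4, (M) 44a79e0badf0 verbatim -/

namespace Summit.HubbardSuperconductivity.HubbardSuperconductivity.Theorems.EngineV8.A24G13

set_option linter.dupNamespace false -- summit = problem name (single-conjunct summit), D-0017

open Real Finset Literature.MathematicalPhysics.QuantumLattice Literature.Probability.LatticeModels
open Summit.HubbardSuperconductivity.HubbardSuperconductivity.Theorems.KLRegimeSplit
open Summit.HubbardSuperconductivity.HubbardSuperconductivity.Theorems.KLProgrammeLegKernels
open Summit.HubbardSuperconductivity.HubbardSuperconductivity.Theorems.DispersionFlow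
open Summit.HubbardSuperconductivity.HubbardSuperconductivity.Theorems.EngineV8

/-- Candidate stub (a) at `klEngGeo13` (row b6bd3a9d49a4 of image 756ee7cf6e79b7c8), by `stub_engine_scale0_G`. -/
theorem stub_engine_scale0 :
    ∀ (P : SplitConsts) (R : RenConsts) (c : ℝ), P.WF → R.WF2 → 0 < c → c ≤ klEngC₃7G klEngGeo13 P R →
      ∀ μ ∈ klWindowC, ∀ U : ℝ, 0 < U → U ≤ klEngU₀12G klEngGeo13 P R c → ∀ β : ℝ, klBetaMin ≤ β → β ≤ Real.exp (c / U ^ 2) →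
        ∀ (L M : ℕ) [NeZero L] [NeZero M], klEngL₄ P R β U ≤ L → klEngM₃ β U L ≤ M →
          FrameOK R U (nScales β) μ (klFlowFrameU L M β U μ 0) →
            KernelNormsV4 L M P (klEngQ9c P R) β U μ (klFlowFrameU L M β U μ 0) 0 ∧
              PairLadderStepAtV17F2 L M klEngGeo13 P (klEngQ9c P R) β U μ 0 ∧
                QuarticValueUVAtV17F L M klEngGeo13 P (klEngQ9c P R) β U μ 0 ∧
                  EngineFirstMoments L M klEngGeo13 P (klEngQ9c P R) β U μ (klFlowFrameU L M β U μ 0) 0 ∧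
                    IsoTupleL1AtV17F L M klEngGeo13 P β U μ 0 :=
  stub_engine_scale0_G klEngGeo13 initDevBar_klEngGeo13 klEngGeo8_cE4_le_klEngGeo13_cE4 klEngGeo8_CF_le_klEngGeo13_CF

/-- Candidate stub (M) at `klEngGeo13` (row 44a79e0badf0), by `stub_twoLeg_scale0_G`. -/
theorem stub_twoLeg_scale0 :
    ∀ (P : SplitConsts) (R : RenConsts) (c : ℝ), P.WF → R.WF2 → 0 < c → c ≤ klEngC₃7G klEngGeo13 P R →
      ∀ μ ∈ klWindowC, ∀ U : ℝ, 0 < U → U ≤ klEngU₀12G klEngGeo13 P R c → ∀ β : ℝ, klBetaMin ≤ β → β ≤ Real.exp (c / U ^ 2) →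
        ∀ (L M : ℕ) [NeZero L] [NeZero M], klEngL₄ P R β U ≤ L → klEngM₃ β U L ≤ M →
          FrameOK R U (nScales β) μ (klFlowFrameU L M β U μ 0) →
            EngineBoundsAtV17F2 L M klEngGeo13 P (klEngQ9c P R) β U μ 0 →
              TwoLegReadJetBound L M klC4aJetC2 (klC4aJetC' P R) β U μ (klFlowFrameU L M β U μ 0) 0 →
                TwoLegStepV17F2 L M klEngGeo13 P (klEngQ9c P R) R β U μ 0 :=
  stub_twoLeg_scale0_G klEngGeo13 klC4aJetC2_le_klEngGeo13_S

end Summit.HubbardSuperconductivity.HubbardSuperconductivity.Theorems.EngineV8.A24G13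

/-! ### rev 15-A24 CANDIDATE «klEngGeo14» (image c83a8f7d69f2f229): rows (a) 120428addd1d, (M) eef18bb42ce4 verbatim -/

namespace Summit.HubbardSuperconductivity.HubbardSuperconductivity.Theorems.EngineV8.A24G14

set_option linter.dupNamespace false -- summit = problem name (single-conjunct summit), D-0017

open Real Finset Literature.MathematicalPhysics.QuantumLattice Literature.Probability.LatticeModels
open Summit.HubbardSuperconductivity.HubbardSuperconductivity.Theorems.KLRegimeSplit
open Summit.HubbardSuperconductivity.HubbardSuperconductivity.Theorems.KLProgrammeLegKernels
open Summit.HubbardSuperconductivity.HubbardSuperconductivity.Theorems.DispersionFlow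
open Summit.HubbardSuperconductivity.HubbardSuperconductivity.Theorems.EngineV8

/-- Candidate stub (a) at `klEngGeo14` (row 120428addd1d of image c83a8f7d69f2f229), by `stub_engine_scale0_G`. -/
theorem stub_engine_scale0 :
    ∀ (P : SplitConsts) (R : RenConsts) (c : ℝ), P.WF → R.WF2 → 0 < c → c ≤ klEngC₃7G klEngGeo14 P R →
      ∀ μ ∈ klWindowC, ∀ U : ℝ, 0 < U → U ≤ klEngU₀12G klEngGeo14 P R c → ∀ β : ℝ, klBetaMin ≤ β → β ≤ Real.exp (c / U ^ 2) →
        ∀ (L M : ℕ) [NeZero L] [NeZero M], klEngL₄ P R β U ≤ L → klEngM₃ β U L ≤ M →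
          FrameOK R U (nScales β) μ (klFlowFrameU L M β U μ 0) →
            KernelNormsV4 L M P (klEngQ9c P R) β U μ (klFlowFrameU L M β U μ 0) 0 ∧
              PairLadderStepAtV17F2 L M klEngGeo14 P (klEngQ9c P R) β U μ 0 ∧
                QuarticValueUVAtV17F L M klEngGeo14 P (klEngQ9c P R) β U μ 0 ∧
                  EngineFirstMoments L M klEngGeo14 P (klEngQ9c P R) β U μ (klFlowFrameU L M β U μ 0) 0 ∧
                    IsoTupleL1AtV17F L M klEngGeo14 P β U μ 0 :=
  stub_engine_scale0_G klEngGeo14 initDevBar_klEngGeo14 klEngGeo8_cE4_le_klEngGeo14_cE4 klEngGeo8_CF_le_klEngGeo14_CF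

/-- Candidate stub (M) at `klEngGeo14` (row eef18bb42ce4), by `stub_twoLeg_scale0_G`. -/
theorem stub_twoLeg_scale0 :
    ∀ (P : SplitConsts) (R : RenConsts) (c : ℝ), P.WF → R.WF2 → 0 < c → c ≤ klEngC₃7G klEngGeo14 P R →
      ∀ μ ∈ klWindowC, ∀ U : ℝ, 0 < U → U ≤ klEngU₀12G klEngGeo14 P R c → ∀ β : ℝ, klBetaMin ≤ β → β ≤ Real.exp (c / U ^ 2) →
        ∀ (L M : ℕ) [NeZero L] [NeZero M], klEngL₄ P R β U ≤ L → klEngM₃ β U L ≤ M →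
          FrameOK R U (nScales β) μ (klFlowFrameU L M β U μ 0) →
            EngineBoundsAtV17F2 L M klEngGeo14 P (klEngQ9c P R) β U μ 0 →
              TwoLegReadJetBound L M klC4aJetC2 (klC4aJetC' P R) β U μ (klFlowFrameU L M β U μ 0) 0 →
                TwoLegStepV17F2 L M klEngGeo14 P (klEngQ9c P R) R β U μ 0 :=
  stub_twoLeg_scale0_G klEngGeo14 klC4aJetC2_le_klEngGeo14_S

end Summit.HubbardSuperconductivity.HubbardSuperconductivity.Theorems.EngineV8.A24G14

end
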